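import Literature.Probability.Percolation.FlipResponse
import Literature.Probability.Percolation.TriHexLemma

/-!
# Colour-flip antisymmetry of the flip response at `p = 1/2`

Helper for crux `stmt-CriticalPhenomena-7029`
(`Summit.CriticalPhenomena.CardyFormulaZ2.Theses.CardyFlipRusso.QuadrupoleSelectionRule`),
line Sketch, stub U2: the measure-theoretic half of the antisymmetry "`Δ_Q(U) = −Δ_Q(U*)`".

For a graph-dependent site-percolation event `U : SimpleGraph V → Set (SiteConfig V)` write
`Δ_Q(U) := flipResponse G A B C D U p = P_p[U (flip G)] − P_p[U G]` for its response to the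
diagonal flip of the quadrilateral `Q = (A, B, C, D)`. The **colour-dual** event family is
`U† G' := {ω | ωᶜ ∉ U G'}` ("the closed sites do NOT realise `U G'`"). At the self-dual density
`p = 1/2` the Bernoulli site measure is invariant under the colour flip `ω ↦ ωᶜ`
(`sitePercolation_map_compl` together with `unitInterval.symm half = half`), so for every graph
`G'` and every measurable `U G'`,
`P_{1/2}[U† G'] = P_{1/2}[compl ⁻¹' (U G')ᶜ] = P_{1/2}[(U G')ᶜ] = 1 − P_{1/2}[U G']`;
subtracting the instances `G' = flip G` and `G' = G` gives
`flipResponse G A B C D U† half = − flipResponse G A B C D U half` (`flipResponse_colourDual`).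

For a self-matching triangulation, `U†` of an open crossing IS the dual (closed, conjugate)
crossing by planar duality; that identification is NOT proved here — only the abstract sign change
under colour duality, which is what the crux's exact-enumeration check of "`Δ_Q(U) = −Δ_Q(U*)`"
reflects on the measure side.
-/

noncomputable section

open Literature.Probability.Percolation MeasureTheory

namespace Summit.CriticalPhenomena.CardyFormulaZ2.Theorems

/-- At the self-dual density `p = 1/2`, the colour-dual of a measurable event `S` has the
complementary probability: `P_{1/2}[{ω | ωᶜ ∉ S}] = 1 − P_{1/2}[S]`. [folklore] -/
theorem sitePercolation_half_real_compl_notMem {V : Type*} (S : Set (SiteConfig V))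
    (hS : MeasurableSet S) :
    (sitePercolation V half).real {ω | ωᶜ ∉ S} = 1 - (sitePercolation V half).real S := by
  have h1 : {ω : SiteConfig V | ωᶜ ∉ S} = compl ⁻¹' Sᶜ := rfl
  have hs : unitInterval.symm half = half := Subtype.ext (by simp [half]; norm_num)
  rw [h1, sitePercolation_real_preimage_compl, hs, measureReal_compl hS, probReal_univ]

/-- **Colour-flip antisymmetry of the flip response at `p = 1/2`**: for a family of measurable
graph-dependent events `U`, the colour-dual family `G' ↦ {ω | ωᶜ ∉ U G'}` responds to the
diagonal flip of `(A, B, C, D)` with the opposite sign,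
`flipResponse G A B C D (fun G' => {ω | ωᶜ ∉ U G'}) half = − flipResponse G A B C D U half`.
[folklore] -/
theorem flipResponse_colourDual {V : Type*} (G : SimpleGraph V) (A B C D : V)
    (U : SimpleGraph V → Set (SiteConfig V)) (hU : ∀ G' : SimpleGraph V, MeasurableSet (U G')) :
    flipResponse G A B C D (fun G' => {ω | ωᶜ ∉ U G'}) half = - flipResponse G A B C D U half := by
  simp only [flipResponse_def, ← measureReal_def]
  rw [sitePercolation_half_real_compl_notMem _ (hU _),
    sitePercolation_half_real_compl_notMem _ (hU _)]
  ring

end Summit.CriticalPhenomena.CardyFormulaZ2.Theorems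

end
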